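import Summits.QuantumFields.YangMills.Theorems.UnitScaleTiltProp7TJDivRowOfColumns
import Summits.QuantumFields.YangMills.Theorems.UnitScaleTiltProp7DeltaPiDefectPairing
import HarnessLib

/-!
# «TJ-DIV DOOR», DICTIONARY — the pure-gauge spike of ✓`Prop7TJDivRowOfColumns.hTJdiv_of_hHcol_hqG`'s row `hqG` IS `−η⁻¹`× THE GAUGE DIRECTION OF ✓`QTwS_gaugeDir_of_avgSeq`:
# `toL2⁻¹(D_{U₀}(toL2S N)) = −η⁻¹ • (b ↦ N(b₋) − U₀(b)N(b₊)U₀(b)⁻¹)`, hence `hqG` ⟸ a «gauge-direction column» of `avgHess` in the currency `qG·ℓ⁻²` (the (q-gauge)-core of S1-SPEC)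

Cell `ym3-torus` (HUMAN RULING D-0037, YM ladder rung R3 — SU(2) YM₃ on T³: NOT d = 4, NOT infinite volume, NOT a mass gap, NOT Clay).  Width seat `ym3-torus-px19` (gen 14);
chair ★`ym-ust-19200-p1` g27 WORD №29 (2); px19 g14 S1-SPEC (19200 evidence #54) item «DICT».  THEOREMS ONLY (0 `def`, 0 `sorry`, default heartbeats);
`--supports stmt-QuantumFields-19200 --as helper`; count-neutral.

THE PRINT.  [Balaban1985BackgroundPropagators] (3.3) p.390 (`(D_Uλ)(b) = η⁻¹(R(U(b))λ(b₊) − λ(b₋))`), (3.114)–(3.115) p.418; [Balaban1985Averaging] Prop. 5 (157) p.42.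

WHAT IS PROVED (member `F`, `h : n ≤ K`, weights `c₀ cB a`, background `U₀`).
* §1 ★ `toL2_symm_DL2_toL2S_eq` — the dictionary: `(toL2 F K c₀).symm (DL2 F n K c₀ U₀ (toL2S F K c₀ N)) = −((eta F n K : ℂ)⁻¹) • (b ↦ N b₋ − U₀♭(b)·N b₊·U₀♭(b)⁻¹)` (✓`DL2_toL2S_eq_toL2_covDη`,
  lit `covDη`∕`covD`∕`R`).
* §2 ★★ `hqG_row_of_gaugeDir_column` — member level: a column bound of `avgHess U₀ X′` against the GAUGE DIRECTION of a site spike, `Σ_y ‖avgHess U₀ X′ (b ↦ N b₋ − U₀♭ N b₊ U₀♭⁻¹) y‖ ≤ qC·s′·‖A‖`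
  for `N := Pi.single x A`, gives `hqG`'s member text with constant `η⁻¹·qC` (linearity of `avgHess U₀ X′`, `norm_smul`).
* §3 ★★★ `hqG_of_gaugeDir_column_family` — the family edition: a «(q-gauge)-core» row in supplier currency `qG L·((L:ℝ)^(K−n))⁻¹^2·s·‖A‖` for the gauge direction gives `hqG` VERBATIM
  (currency `qG L·((L:ℝ)^(K−n))⁻¹·s·‖A‖`), since `η⁻¹·ℓ⁻² = ℓ⁻¹`.
HONEST SCOPE.  A dictionary and two linear-bookkeeping doors; the (q-gauge)-core row itself (S1-SPEC (2)+(T1)–(T3)) is NOT proved here; nothing of `T_J`'s divergence row beyond ✓p768852's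
conditional door, norm_G, EX, the crux or rung R3 is proved; the Yang–Mills mass gap is NOT proved.

References: T. Bałaban, CMP **99** (1985) 389–434 [Balaban1985BackgroundPropagators] ((3.3) p.390, (3.114)–(3.115) p.418); CMP **98** (1985) 17–51 [Balaban1985Averaging] (Prop. 5 (157) p.42).
-/

set_option autoImplicit false

noncomputable section

open scoped Matrix.Norms.L2Operator BigOperators

namespace Summit.QuantumFields.YangMills.Theorems.Prop7TJDivGaugeDirDict

open Literature.MathematicalPhysics.QuantumFieldTheory.Balaban1983to89
open Literature.MathematicalPhysics.QuantumFieldTheory.Balaban1983to89.T3ContinuumYM3Torus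
open Literature.MathematicalPhysics.QuantumFieldTheory.Balaban1983to89.T3Thm1Carrier (Idx)
open T3SectALandauChart (bgUnits eta eta_pos)
open T3PrintedRegularMinimiser (RegPr)
open B9TorusCalculus (torusT torusT_apply)
open B9Eq39Adjoint (R R_def covD)
open B9Eq3117Current (covDη covDη_apply)
open Summit.QuantumFields.YangMills.Theorems.Prop7SectET3HilbertLetters (W₂ toL2 toL2S DL2)
open Summit.QuantumFields.YangMills.Theorems.Prop7SectET3DeltaOne (avgHess)
open Summit.QuantumFields.YangMills.Theorems.Prop7DeltaPiDefectPairing (DL2_toL2S_eq_toL2_covDη)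

variable {F : T3Family} {n K : ℕ} {h : n ≤ K} {c₀ : ℝ} [Fact (0 < c₀)]

/-! ## §1 The dictionary -/

/-- ★ **THE PURE-GAUGE SPIKE IN THE ROUTE's LETTERS**: `toL2⁻¹(D_{U₀}(toL2S N))(b) = −η⁻¹·(N(b₋) − U₀♭(b)·N(b₊)·U₀♭(b)⁻¹)` — the `L²`-letter covariant gradient of a site field read back on
the route carrier is `−η⁻¹` times the gauge direction of ✓`Prop7SymAvgTwSGaugeDir.QTwS_gaugeDir_of_avgSeq`. [cite: Balaban1985BackgroundPropagators, (3.3) p.390] -/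
theorem toL2_symm_DL2_toL2S_eq (U₀ : GaugeField (F.P K) 0 (Matrix.specialUnitaryGroup (Fin 2) ℂ)) (N : Site (F.P K) 0 → Matrix (Fin 2) (Fin 2) ℂ) :
    (toL2 F K c₀).symm (DL2 F n K c₀ U₀ (toL2S F K c₀ N))
      = -(((eta F n K : ℝ) : ℂ)⁻¹) • (fun b : PBond (F.P K) 0 =>
          N b.src - ((bgUnits F K U₀ b : (Matrix (Fin 2) (Fin 2) ℂ)ˣ) : Matrix (Fin 2) (Fin 2) ℂ) * N b.tgt * (((bgUnits F K U₀ b)⁻¹ : (Matrix (Fin 2) (Fin 2) ℂ)ˣ) : Matrix (Fin 2) (Fin 2) ℂ)) := by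
  rw [DL2_toL2S_eq_toL2_covDη, LinearEquiv.symm_apply_apply]
  funext b
  rw [Pi.smul_apply, covDη_apply, neg_smul, ← smul_neg, neg_sub]
  congr 1

/-! ## §2 The member door: `hqG`'s text from a gauge-direction column -/

/-- ★★ **`hqG` AT A MEMBER FROM A GAUGE-DIRECTION COLUMN OF `avgHess`**: if for every bounded `X′` (`sup ≤ s′`) and every site spike `N := δ_x ⊗ A` the column of `avgHess U₀ X′` against the
GAUGE DIRECTION `b ↦ N(b₋) − U₀♭(b)N(b₊)U₀♭(b)⁻¹` is `≤ qC·s′·‖A‖`, then the row `hQG` of ✓`Prop7TJDivRowOfColumns.norm_DstarL2_TJP_apply_le_of_columns` holds with `qG := η⁻¹·qC`.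
[cite: Balaban1985BackgroundPropagators, (3.114)–(3.115) p.418; Balaban1985Averaging, Prop. 5 (157) p.42] -/
theorem hqG_row_of_gaugeDir_column (U₀ : GaugeField (F.P K) 0 (Matrix.specialUnitaryGroup (Fin 2) ℂ)) {qC : ℝ}
    (hcol : ∀ (X' : PBond (F.P K) 0 → Matrix (Fin 2) (Fin 2) ℂ) (s' : ℝ) (x : Site (F.P K) 0) (A : Matrix (Fin 2) (Fin 2) ℂ), (∀ b, ‖X' b‖ ≤ s') →
      ∑ y : PBond (F.P n) 0, ‖avgHess F n K h U₀ X' (fun b : PBond (F.P K) 0 =>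
          (Pi.single x A : Site (F.P K) 0 → Matrix (Fin 2) (Fin 2) ℂ) b.src
            - ((bgUnits F K U₀ b : (Matrix (Fin 2) (Fin 2) ℂ)ˣ) : Matrix (Fin 2) (Fin 2) ℂ) * (Pi.single x A : Site (F.P K) 0 → Matrix (Fin 2) (Fin 2) ℂ) b.tgt
              * (((bgUnits F K U₀ b)⁻¹ : (Matrix (Fin 2) (Fin 2) ℂ)ˣ) : Matrix (Fin 2) (Fin 2) ℂ)) y‖ ≤ qC * s' * ‖A‖) :
    ∀ (X' : PBond (F.P K) 0 → Matrix (Fin 2) (Fin 2) ℂ) (s' : ℝ) (x : Site (F.P K) 0) (A : Matrix (Fin 2) (Fin 2) ℂ), (∀ b, ‖X' b‖ ≤ s') →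
      ∑ y : PBond (F.P n) 0, ‖avgHess F n K h U₀ X' ((toL2 F K c₀).symm (DL2 F n K c₀ U₀ (toL2S F K c₀ (Pi.single x A)))) y‖ ≤ (eta F n K)⁻¹ * qC * s' * ‖A‖ := by
  intro X' s' x A hX'
  have hη : 0 < eta F n K := eta_pos F n K
  rw [toL2_symm_DL2_toL2S_eq, map_smul]
  have hnorm : ‖-(((eta F n K : ℝ) : ℂ)⁻¹)‖ = (eta F n K)⁻¹ := by
    rw [norm_neg, norm_inv, Complex.norm_real, Real.norm_of_nonneg hη.le]
  calc ∑ y : PBond (F.P n) 0, ‖((-(((eta F n K : ℝ) : ℂ)⁻¹)) • avgHess F n K h U₀ X' (fun b : PBond (F.P K) 0 =>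
          (Pi.single x A : Site (F.P K) 0 → Matrix (Fin 2) (Fin 2) ℂ) b.src
            - ((bgUnits F K U₀ b : (Matrix (Fin 2) (Fin 2) ℂ)ˣ) : Matrix (Fin 2) (Fin 2) ℂ) * (Pi.single x A : Site (F.P K) 0 → Matrix (Fin 2) (Fin 2) ℂ) b.tgt
              * (((bgUnits F K U₀ b)⁻¹ : (Matrix (Fin 2) (Fin 2) ℂ)ˣ) : Matrix (Fin 2) (Fin 2) ℂ))) y‖
      = (eta F n K)⁻¹ * ∑ y : PBond (F.P n) 0, ‖avgHess F n K h U₀ X' (fun b : PBond (F.P K) 0 =>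
          (Pi.single x A : Site (F.P K) 0 → Matrix (Fin 2) (Fin 2) ℂ) b.src
            - ((bgUnits F K U₀ b : (Matrix (Fin 2) (Fin 2) ℂ)ˣ) : Matrix (Fin 2) (Fin 2) ℂ) * (Pi.single x A : Site (F.P K) 0 → Matrix (Fin 2) (Fin 2) ℂ) b.tgt
              * (((bgUnits F K U₀ b)⁻¹ : (Matrix (Fin 2) (Fin 2) ℂ)ˣ) : Matrix (Fin 2) (Fin 2) ℂ)) y‖ := by
        rw [Finset.mul_sum]
        exact Finset.sum_congr rfl fun y _ => by rw [Pi.smul_apply, norm_smul, hnorm]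
    _ ≤ (eta F n K)⁻¹ * (qC * s' * ‖A‖) := mul_le_mul_of_nonneg_left (hcol X' s' x A hX') (inv_nonneg.2 hη.le)
    _ = (eta F n K)⁻¹ * qC * s' * ‖A‖ := by ring

/-! ## §3 The family door: `hqG` VERBATIM from a «(q-gauge)-core» row in the currency `qG·ℓ⁻²` -/

/-- ★★★ **`hqG` OF ✓`hTJdiv_of_hHcol_hqG` FROM THE (q-gauge)-CORE ROW**: if at every member `i : Idx L` and every `U₀ ∈ 𝔘_k(α L)` the column of `avgHess U₀ X′` against the gauge direction of
a site spike is `≤ qG L·((L:ℝ)^(K−n))⁻¹^2·s·‖A‖` (S1-SPEC's «ℓ⁻²»), then `hqG` holds TOKEN FOR TOKEN in its supplier currency `qG L·((L:ℝ)^(K−n))⁻¹·s·‖A‖` (`η⁻¹·ℓ⁻² = ℓ⁻¹`).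
[cite: Balaban1985BackgroundPropagators, (3.114)–(3.115) p.418; Balaban1985Averaging, Prop. 5 (157) p.42] -/
theorem hqG_of_gaugeDir_column_family (α qG : ℕ → ℝ) (c₀ : ℕ → ℝ) [hc₀ : ∀ L : ℕ, Fact (0 < c₀ L)]
    (hcore : ∀ (L : ℕ), 1 < L → ∀ (i : Idx L) (U₀ : GaugeField (i.1.1.P i.1.2.2) 0 (Matrix.specialUnitaryGroup (Fin 2) ℂ)), RegPr i.1.1 i.1.2.1 i.1.2.2 (α L) U₀ →
      ∀ (X' : PBond (i.1.1.P i.1.2.2) 0 → Matrix (Fin 2) (Fin 2) ℂ) (s : ℝ) (x : Site (i.1.1.P i.1.2.2) 0) (A : Matrix (Fin 2) (Fin 2) ℂ), (∀ b, ‖X' b‖ ≤ s) →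
        ∑ y : PBond (i.1.1.P i.1.2.1) 0, ‖avgHess i.1.1 i.1.2.1 i.1.2.2 i.2.2.le U₀ X' (fun b : PBond (i.1.1.P i.1.2.2) 0 =>
            (Pi.single x A : Site (i.1.1.P i.1.2.2) 0 → Matrix (Fin 2) (Fin 2) ℂ) b.src
              - ((bgUnits i.1.1 i.1.2.2 U₀ b : (Matrix (Fin 2) (Fin 2) ℂ)ˣ) : Matrix (Fin 2) (Fin 2) ℂ) * (Pi.single x A : Site (i.1.1.P i.1.2.2) 0 → Matrix (Fin 2) (Fin 2) ℂ) b.tgt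
                * (((bgUnits i.1.1 i.1.2.2 U₀ b)⁻¹ : (Matrix (Fin 2) (Fin 2) ℂ)ˣ) : Matrix (Fin 2) (Fin 2) ℂ)) y‖
          ≤ qG L * (((L : ℝ) ^ (i.1.2.2 - i.1.2.1))⁻¹) ^ 2 * s * ‖A‖) :
    ∀ (L : ℕ), 1 < L → ∀ (i : Idx L) (U₀ : GaugeField (i.1.1.P i.1.2.2) 0 (Matrix.specialUnitaryGroup (Fin 2) ℂ)), RegPr i.1.1 i.1.2.1 i.1.2.2 (α L) U₀ →
      ∀ (X' : PBond (i.1.1.P i.1.2.2) 0 → Matrix (Fin 2) (Fin 2) ℂ) (s : ℝ) (x : Site (i.1.1.P i.1.2.2) 0) (A : Matrix (Fin 2) (Fin 2) ℂ), (∀ b, ‖X' b‖ ≤ s) →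
        ∑ y : PBond (i.1.1.P i.1.2.1) 0, ‖avgHess i.1.1 i.1.2.1 i.1.2.2 i.2.2.le U₀ X'
            ((toL2 i.1.1 i.1.2.2 (c₀ L)).symm (DL2 i.1.1 i.1.2.1 i.1.2.2 (c₀ L) U₀ (toL2S i.1.1 i.1.2.2 (c₀ L) (Pi.single x A)))) y‖
          ≤ qG L * ((L : ℝ) ^ (i.1.2.2 - i.1.2.1))⁻¹ * s * ‖A‖ := by
  intro L hL i U₀ hU X' s x A hX'
  have hrow := hqG_row_of_gaugeDir_column (h := i.2.2.le) (c₀ := c₀ L) U₀ (hcore L hL i U₀ hU) X' s x A hX'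
  have hη : eta i.1.1 i.1.2.1 i.1.2.2 = ((L : ℝ) ^ (i.1.2.2 - i.1.2.1))⁻¹ := by
    have hLi : (i.1.1.L : ℝ) = (L : ℝ) := by exact_mod_cast i.2.1
    show ((i.1.1.L : ℝ)⁻¹) ^ (i.1.2.2 - i.1.2.1) = _
    rw [hLi, inv_pow]
  have hLpos : (0 : ℝ) < L := by exact_mod_cast (zero_lt_one.trans hL)
  have hM : (0 : ℝ) < (L : ℝ) ^ (i.1.2.2 - i.1.2.1) := pow_pos hLpos _
  rw [hη] at hrow
  calc _ ≤ (((L : ℝ) ^ (i.1.2.2 - i.1.2.1))⁻¹)⁻¹ * (qG L * (((L : ℝ) ^ (i.1.2.2 - i.1.2.1))⁻¹) ^ 2) * s * ‖A‖ := hrow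
    _ = qG L * ((L : ℝ) ^ (i.1.2.2 - i.1.2.1))⁻¹ * s * ‖A‖ := by field_simp

end Summit.QuantumFields.YangMills.Theorems.Prop7TJDivGaugeDirDict

end
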